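import Literature.Geometry.Kaehler.DeformationEquivalence
import Literature.Geometry.Kaehler.Kaehler
import Literature.Geometry.Kaehler.ManifoldForms
import Literature.Geometry.Kaehler.HolomorphicChartForms
import Literature.Geometry.Hyperkaehler.IrreducibleSymplectic
import Literature.Geometry.Hyperkaehler.AutomorphismsTrivialOnH2LocalSystem
import HarnessLib

/-!
# The central fibre of a degeneration of hyperkähler manifolds over a disc is Kähler (Liu–Shen 2026, Thm. 1.5 = Thm. 8.3) — UNREFEREED CLAIM (`@[claim … "under-review"]`, D-0012), grade PREPRINT; the Kähler strengthening of Soldatenkov–Verbitsky 2024 Conj. 1.2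

HONEST FRAMING: typed ≠ proved ≠ endorsed.  Nothing in this file asserts `HodgeConjecture`, `HC_AV`,
`W₆`, `HC_Kum4Type` or the statement below, and nothing here is REFEREED: the one declaration is a
named `Prop` tagged `@[claim "LiuShen2026" "under-review"]` — an UNREFEREED claim in the sense of
D-0012 (counted apart from cited facts in the trust base), grade word **PREPRINT** (arXiv, May 2026,
resting on two companion preprints of the same authors).  It is typed, on the tree's family carriers
(`Literature/Geometry/Kaehler/DeformationEquivalence`), because director-hodge g5 recorded it for the next
LT-H3 typer plate (hodge-kum4 INBOX 2026-08-26T19:26:55Z (f): «Liu–Shen 2026 Thm 1.5 as a PREPRINT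
family-form fact on the Geometry.Kaehler family carriers so the parked option is inputs-complete»): it is
the tree-vocabulary form of the ONE «closedness» input that hodge-kum4 plan g13 (A4-BOOKING.md §6–§7)
and the director's REVISIT TRIGGER (iii) name for the located gap of the (parked, NOT booked) kernel
derivation of F125X — «one fibre irreducible symplectic ⇒ every fibre irreducible symplectic» along the
unrestricted Kodaira chains of `Literature.Geometry.Kaehler.IsDeformationOf` (Huybrechts 1999 §2 open
problem; disc case = Soldatenkov–Verbitsky 2024 Conj. 1.2).  When (if) the claim appears in a refereed
venue, the tag becomes `[cite: …]` with the journal locator and the grade word REFEREED — the body does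
not change.  Cross-ladder literature-typing layer D-0088(4), tranche LT-H3, seat
`hodge-lit-kumfamily-typer` g2.

## Sources (read at source; locators = files of the materialised arXiv texts)

* [LS26] K. Liu, Y. Shen, *Degenerations and Stability of Kähler Structures on Calabi–Yau Manifolds*,
  arXiv:2605.18065 (May 2026), bib `LiuShen2026` [PREPRINT].  Conventions
  [corpus:paper-arxiv-2605.18065 p0004:L28–L33], verbatim: "Recall that a compact complex manifold `X` is
  called holomorphically symplectic if it admits a closed holomorphic two-form `σ ∈ H⁰(X, Ω²_X)` which
  is everywhere non-degenerate.  A compact hyperkähler manifold is a compact Kähler holomorphically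
  symplectic manifold such that `X` is simply connected and `H^{2,0}(X) = ℂσ`.  Equivalently, these are
  the irreducible holomorphic symplectic manifolds of Beauville." (again p0017:L6–L7).  **Theorem 1.5**
  [p0004:L71–L72] = **Theorem 8.3** [p0018:L93–L94], verbatim: "Let `f : 𝒳 → Δ` be an analytic family
  of compact complex manifolds over a disk `Δ ⊂ ℂ`. Suppose that `X_t` is hyperkähler for
  `t ∈ Δ* = Δ ∖ {0}`. Then the central fiber `X₀` is Kähler. In particular, if `X₀` is moreover
  holomorphically symplectic, then `X₀` is hyperkähler."  Printed proof route [p0018:L90–L91;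
  p0004:L68–L70]: Griffiths ∕ Schmid extension of the period map across the origin + their Thm. 1.4 =
  Thm. 8.1 (limits of diffeomorphic hyperkähler manifolds with bounded periods are Kähler), which rests
  on the authors' companion preprints arXiv:2602.13951 ("global Kähler stability") and arXiv:2602.13947.
  Venue ∕ refereeing status: NONE known at typing time (arXiv only) — hence `under-review`.
* [SV24] A. Soldatenkov, M. Verbitsky, *Hermitian-symplectic and Kähler structures on degenerate
  twistor deformations*, arXiv:2407.07867v2, bib `SoldatenkovVerbitsky2024` — where the PROBLEM is
  stated.  **Conjecture 1.2** [corpus:paper-arxiv-2407.07867 p0004:L20–L23], verbatim: "Let `(M_t, Ω_t)`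
  be a smooth family of compact holomorphically symplectic manifolds over a disk `Δ`. Assume that all
  fibers except the central one are hyperkähler. Then the central fiber `(M₀, Ω₀)` is of Fujiki
  class C."; Conj. 1.3 [p0005:L23–L25] ([LL]: all fibres but the central one Kähler ⇒ central fibre
  class C); partial results in print: their Prop. 4.5 (central fibre Hermitian symplectic), [LL] under
  (a)–(b), Perego.  NOT TYPED: "Fujiki class C" (bimeromorphic to a compact Kähler manifold) has no
  carrier in the tree (no meromorphic maps), and a conjecture is not Literature anyway; class C would
  also not serve the H3 consumer (non-Kähler class-C holomorphically symplectic manifolds exist, [SV24]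
  p0004:L3–L8) — the Kähler form [LS26] is the relevant one, and it implies Conj. 1.2.

## Rendering (tree carriers only; every notion REUSED BY NAME, nothing re-declared)

* "analytic family of compact complex manifolds over a disk `Δ ⊂ ℂ`" (Kodaira Def. 2.8) =
  `Literature.Geometry.Kaehler.IsProperHolomorphicSubmersion E𝒳 ℂ π` for `π : 𝒳 → Δ`, `Δ` an open disc
  `Metric.ball c r` of `ℂ` seen as `TopologicalSpace.Opens ℂ` with its open-submanifold structure
  (charted on `ℂ`), total space Hausdorff and second countable (standing conventions, as in
  `IsDeformationOf` and `HassettTschinkel2013_holAutZero_localSystem`); the centre is the point `o : Δ`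
  with `(o : ℂ) = c` (so `0 < r`).
* "the fibre `X_t`" = any bundled complex manifold `X : ComplexManifold` identified with `π⁻¹(t)` by a
  fibre embedding `IsFibreEmbedding X.model E𝒳 π t ι` (Kodaira Def. 2.8 (i)–(ii); the tree puts no
  charted-space structure on the subtype `π⁻¹(t)`).  The hypothesis on the fibres `t ≠ o` is stated in
  ∃-form (some model of the fibre is hyperkähler), the conclusions on the central fibre in ∀-form (for
  every model of `π⁻¹(o)`) — both properties are biholomorphic invariants, so this is the printed
  meaning, and the ∀-form can only make the statement WEAKER (vacuous) where no model is exhibited.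
* "hyperkähler" [LS26 p0004:L31–L33] = Beauville ∕ Huybrechts 1999 Def. 1.1 =
  `Literature.Geometry.Kaehler.ComplexManifold.IsIrreducibleSymplectic` (compact, Kähler, simply
  connected, `H⁰(Ω²)` spanned by an everywhere non-degenerate holomorphic `2`-form; closedness of that
  form is automatic on a compact Kähler manifold and is, as in the tree's definition, not a clause).
* "`X₀` is Kähler" = `Literature.Geometry.Kaehler.IsKaehlerManifold X₀.model X₀` (a smooth Kähler metric
  exists), the real `C^∞` structure being the one underlying the complex structure
  (`isManifold_real_of_isManifold_complex`, supplied explicitly exactly as in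
  `ComplexManifold.IsIrreducibleSymplectic`).
* "`X₀` holomorphically symplectic" [LS26 p0004:L28–L30] = there is a `2`-form
  `σ : MForm 𝓘(ℝ, X₀.model) X₀ ℂ 2`, holomorphic in charts (`IsHolomorphicInCharts`), CLOSED
  (`IsClosedForm`, i.e. `mextDeriv σ = 0` — a genuine clause here, `X₀` not being known Kähler a
  priori) and non-degenerate at every point (`MForm.IsNondegenerateAt`); compactness of `X₀` is automatic
  (fibre of a proper map, `IsFibreEmbedding.compactSpace`).

## Faithfulness

`LiuShen2026_hyperkaehlerDegeneration_centralFibre` — FAITHFUL to [LS26] Thm. 8.3 (both sentences; the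
first = Thm. 1.5) as ONE named statement (one theorem in print ⇒ one `def`, D-0026 accounting: net +1,
tag `claim`); grade PREPRINT; the disc is any open disc of `ℂ` (printed: "a disk `Δ ⊂ ℂ`").  Not
claimed anywhere in this file: that the statement is proved or refereed; anything about bases other
than a disc (in particular NOT the connected-base propagation «one fibre IHS ⇒ all fibres IHS», which
would in addition use Kodaira–Spencer stability, Beauville's small-deformation theorem, the
Beauville–Bogomolov decomposition and semicontinuity — none of them typed on these carriers at the
time of writing), about non-compact or singular fibres, about `HC_Kum4Type`, `HC_AV`, `W₆` or
`HodgeConjecture`.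
-/

noncomputable section

open scoped Manifold ContDiff Topology
open Function Set
open Literature.Geometry.Kaehler

universe u

namespace Literature.Geometry.Hyperkaehler

/-- **Liu–Shen 2026, Thm. 1.5 = Thm. 8.3 — UNREFEREED CLAIM, grade PREPRINT (arXiv:2605.18065, May
2026; rests on arXiv:2602.13951 ∕ 2602.13947), NOT a refereed fact, NOT proved here:** "Let `f : 𝒳 → Δ`
be an analytic family of compact complex manifolds over a disk `Δ ⊂ ℂ`. Suppose that `X_t` is
hyperkähler for `t ∈ Δ* = Δ ∖ {0}`. Then the central fiber `X₀` is Kähler. In particular, if `X₀` is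
moreover holomorphically symplectic, then `X₀` is hyperkähler."  Rendering (module docstring):
`π : 𝒳 → Δ` a proper holomorphic submersion onto an open disc `Δ = B(c, r) ⊂ ℂ` (total space Hausdorff,
second countable), every fibre over `t ≠ o` (`o` the centre) has a hyperkähler (= irreducible
symplectic, Huybrechts Def. 1.1) model; conclusion, for every complex manifold `X₀` identified with the
central fibre `π⁻¹(o)`: (1) `X₀` is Kähler, and (2) if `X₀` carries a closed holomorphic `2`-form which
is non-degenerate everywhere, then `X₀` is irreducible symplectic.  The Kähler strengthening of the
PROBLEM stated as Soldatenkov–Verbitsky 2024 Conj. 1.2 (class C; bib `SoldatenkovVerbitsky2024`).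
Locator: [LS26] Thm. 1.5 p. 4 = Thm. 8.3 p. 18 (arXiv v1 pagination).
[claim: LiuShen2026, status: under-review] -/
@[claim "LiuShen2026" "under-review"]
def LiuShen2026_hyperkaehlerDegeneration_centralFibre : Prop :=
  ∀ ⦃E𝒳 : Type u⦄ [NormedAddCommGroup E𝒳] [NormedSpace ℂ E𝒳] [FiniteDimensional ℂ E𝒳]
    ⦃𝒳 : Type u⦄ [TopologicalSpace 𝒳] [ChartedSpace E𝒳 𝒳] [IsManifold 𝓘(ℂ, E𝒳) ω 𝒳]
    [T2Space 𝒳] [SecondCountableTopology 𝒳]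
    -- the base: an open disc `Δ = B(c, r)` of `ℂ` with its open-submanifold structure, centre `o`
    ⦃Δ : TopologicalSpace.Opens ℂ⦄ ⦃c : ℂ⦄ ⦃r : ℝ⦄, (Δ : Set ℂ) = Metric.ball c r →
    ∀ ⦃o : Δ⦄, (o : ℂ) = c →
    -- an analytic family of compact complex manifolds over `Δ`
    ∀ ⦃π : 𝒳 → Δ⦄, IsProperHolomorphicSubmersion E𝒳 ℂ π →
    -- `X_t` is hyperkähler for every `t ≠ o`
    (∀ t : Δ, t ≠ o → ∃ (X : ComplexManifold.{u}) (ι : X → 𝒳),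
        IsFibreEmbedding X.model E𝒳 π t ι ∧ X.IsIrreducibleSymplectic) →
    -- then, for (every model of) the central fibre `X₀ = π⁻¹(o)`:
    ∀ (X₀ : ComplexManifold.{u}) (ι₀ : X₀ → 𝒳), IsFibreEmbedding X₀.model E𝒳 π o ι₀ →
      -- (1) `X₀` is Kähler …
      @IsKaehlerManifold X₀.model _ _ X₀ _ _ isManifold_real_of_isManifold_complex _ _ ∧
      -- (2) … and if `X₀` is holomorphically symplectic (a CLOSED holomorphic `2`-form, everywhere
      -- non-degenerate), then `X₀` is hyperkähler (irreducible symplectic)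
      ((∃ σ : MForm 𝓘(ℝ, X₀.model) X₀ ℂ 2,
          IsHolomorphicInCharts σ ∧ IsClosedForm σ ∧ ∀ x : X₀, σ.IsNondegenerateAt x) →
        X₀.IsIrreducibleSymplectic)

/-- The first sentence alone (Thm. 1.5): under the hypotheses of
`LiuShen2026_hyperkaehlerDegeneration_centralFibre`, every model of the central fibre is Kähler —
projection of the claim, PROVED from it (no new fact). [claim: LiuShen2026, status: under-review] -/
theorem LiuShen2026_hyperkaehlerDegeneration_centralFibre.kaehler
    (h : LiuShen2026_hyperkaehlerDegeneration_centralFibre.{u})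
    {E𝒳 : Type u} [NormedAddCommGroup E𝒳] [NormedSpace ℂ E𝒳] [FiniteDimensional ℂ E𝒳]
    {𝒳 : Type u} [TopologicalSpace 𝒳] [ChartedSpace E𝒳 𝒳] [IsManifold 𝓘(ℂ, E𝒳) ω 𝒳]
    [T2Space 𝒳] [SecondCountableTopology 𝒳]
    {Δ : TopologicalSpace.Opens ℂ} {c : ℂ} {r : ℝ} (hΔ : (Δ : Set ℂ) = Metric.ball c r)
    {o : Δ} (ho : (o : ℂ) = c) {π : 𝒳 → Δ} (hπ : IsProperHolomorphicSubmersion E𝒳 ℂ π)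
    (hHK : ∀ t : Δ, t ≠ o → ∃ (X : ComplexManifold.{u}) (ι : X → 𝒳),
        IsFibreEmbedding X.model E𝒳 π t ι ∧ X.IsIrreducibleSymplectic)
    (X₀ : ComplexManifold.{u}) (ι₀ : X₀ → 𝒳) (hι₀ : IsFibreEmbedding X₀.model E𝒳 π o ι₀) :
    @IsKaehlerManifold X₀.model _ _ X₀ _ _ isManifold_real_of_isManifold_complex _ _ :=
  (h hΔ ho hπ hHK X₀ ι₀ hι₀).1

/-- The second sentence alone (Thm. 8.3, "in particular"): under the same hypotheses, a model of the
central fibre carrying a closed, everywhere non-degenerate holomorphic `2`-form is irreducible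
symplectic — projection of the claim, PROVED from it (no new fact).
[claim: LiuShen2026, status: under-review] -/
theorem LiuShen2026_hyperkaehlerDegeneration_centralFibre.isIrreducibleSymplectic
    (h : LiuShen2026_hyperkaehlerDegeneration_centralFibre.{u})
    {E𝒳 : Type u} [NormedAddCommGroup E𝒳] [NormedSpace ℂ E𝒳] [FiniteDimensional ℂ E𝒳]
    {𝒳 : Type u} [TopologicalSpace 𝒳] [ChartedSpace E𝒳 𝒳] [IsManifold 𝓘(ℂ, E𝒳) ω 𝒳]
    [T2Space 𝒳] [SecondCountableTopology 𝒳]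
    {Δ : TopologicalSpace.Opens ℂ} {c : ℂ} {r : ℝ} (hΔ : (Δ : Set ℂ) = Metric.ball c r)
    {o : Δ} (ho : (o : ℂ) = c) {π : 𝒳 → Δ} (hπ : IsProperHolomorphicSubmersion E𝒳 ℂ π)
    (hHK : ∀ t : Δ, t ≠ o → ∃ (X : ComplexManifold.{u}) (ι : X → 𝒳),
        IsFibreEmbedding X.model E𝒳 π t ι ∧ X.IsIrreducibleSymplectic)
    (X₀ : ComplexManifold.{u}) (ι₀ : X₀ → 𝒳) (hι₀ : IsFibreEmbedding X₀.model E𝒳 π o ι₀)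
    (hσ : ∃ σ : MForm 𝓘(ℝ, X₀.model) X₀ ℂ 2,
        IsHolomorphicInCharts σ ∧ IsClosedForm σ ∧ ∀ x : X₀, σ.IsNondegenerateAt x) :
    X₀.IsIrreducibleSymplectic :=
  (h hΔ ho hπ hHK X₀ ι₀ hι₀).2 hσ

end Literature.Geometry.Hyperkaehler

end
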